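import Mathlib
import Literature.Probability.LatticeModels.BrillouinRiemannSum

/-!
# Riemann sums over the momentum grid of the torus: the RATE `O(ω_G(2π/L))`, `O(Lip(G)/L)`

Topic `Probability/LatticeModels`; companion of `BrillouinRiemannSum.lean` (`cornerRiemannSum`,
`tendsto_cornerRiemannSum`: qualitative convergence for continuous integrands) and
`BrillouinRiemannSumUniform.lean` (uniformity in a compact parameter), on the grid-cell tiling of
`LatticeGreenRiemannSum.lean` (`gridStep L = 2π/L`, `cellCorner`, `gridCell`, `card_torusSite`).
Those files give `δ^d Σ_j G(c_j) → ∫_{[-π,π]^d} G` with NO rate.  For the two-volume comparisons of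
finite-volume lattice perturbation theory (a per-volume statement «the volume-`L` value is within
`C/L` of every later volume's value», e.g. the rate-form volume slot `TwoLegVolumeRate` of the
Hubbard KL programme, `Summits/HubbardSuperconductivity/…/KLProgrammeKLRegimeSplitBundleV7`) one needs
the elementary QUANTITATIVE form, PROVED here for functions with values in any real Banach space and
every side `L ≥ 1` (no parity restriction, no compactness in parameters — the bound is explicit):

* `norm_cornerRiemannSum_sub_integral_le_of_modulus` — if `‖G p - G q‖ ≤ η` whenever
  `p, q ∈ [-π,π]^d` are within `δ = 2π/L` in the sup metric, then
  `‖δ^d Σ_j G(c_j) - ∫_{[-π,π]^d} G‖ ≤ (2π)^d η` (each of the `L^d` cells contributes `≤ η δ^d`);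
* `norm_cornerRiemannSum_sub_integral_le_of_lipschitzOnWith` — for `G` `K`-Lipschitz on the zone
  (sup metric): `≤ (2π)^d K δ = (2π)^{d+1} K / L` (`…_le_div`);
* `latticeMomentum_eq_cellCorner_add_pi`, `sum_latticeMomentum_eq_sum_cellCorner_shift`,
  `momentumAverage_eq_smul_cornerRiemannSum_shift` — for EVERY `L ≥ 1` the momentum grid
  `p_k = 2πk/L ∈ [0,2π)^d` is the corner grid shifted by `(π,…,π)`, so
  `L^{-d} Σ_k G(p_k) = (2π)^{-d} · δ^d Σ_j G(c_j + π)`;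
* `norm_momentumAverage_sub_integral_le_of_lipschitzOnWith` — for `G` `K`-Lipschitz on `[0,2π]^d`:
  **`‖L^{-d} Σ_{k ∈ (ℤ/Lℤ)^d} G(2πk/L) - (2π)^{-d} ∫_{[-π,π]^d} G(q + π) dq‖ ≤ K · 2π/L`** for all `L ≥ 1`
  (for a `2π`-periodic `G` the shifted integral is `∫_{[-π,π]^d} G`; consumers rewrite it with their
  own periodicity lemma, as `HubbardFreePropagatorLimit` does).

Everything is proved; no definitions. [folklore]

## Mathlib / tree search

`lean search 'cornerRiemannSum|momentumAverage'` — only the qualitative statements above and the two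
singular special cases of `LatticeGreenRiemannSum` / `XYOrderRiemannSumProofs`; Mathlib's
`BoxIntegral` has tagged-partition Riemann sums but no statement along the uniform grid `L → ∞`.
Used: `norm_setIntegral_le_of_norm_le_const`, `LipschitzOnWith.dist_le_mul`.

## References

* W. Rudin, *Principles of Mathematical Analysis*, 3rd ed., Thm. 6.8 / 6.10 (Riemann sums of a
  uniformly continuous function: the error of a tagged sum is at most the oscillation times the
  measure). [Rudin1976]
* S. Friedli, Y. Velenik, *Statistical Mechanics of Lattice Systems* (CUP 2017), §10.5.2, (10.41)
  (momentum sums of the torus as Riemann sums over the Brillouin zone). [FriedliVelenikSMLS2017]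
-/

noncomputable section

namespace Literature.Probability.LatticeModels

open MeasureTheory Finset Real
open scoped NNReal

variable {d : ℕ} {E : Type*} [NormedAddCommGroup E] [NormedSpace ℝ E] [CompleteSpace E]

/-! ### Corner Riemann sums: the rate from a modulus of continuity at the grid scale -/

/-- **Rate for corner Riemann sums from a modulus at the grid scale.** If `G` is continuous on
`[-π,π]^d` and `‖G p - G q‖ ≤ η` for all `p, q` in the zone at sup-distance `≤ δ = 2π/L`, then
`‖δ^d Σ_j G(c_j) - ∫_{[-π,π]^d} G‖ ≤ (2π)^d · η`: the cell `c_j + [0,δ)^d` has sup-radius `δ` about its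
corner, so it contributes at most `η · δ^d`, and there are `L^d = (2π/δ)^d` cells.
[cite: Rudin1976, Thm. 6.8 / 6.10] -/
theorem norm_cornerRiemannSum_sub_integral_le_of_modulus {L : ℕ} [NeZero L]
    {G : (Fin d → ℝ) → E} (hG : ContinuousOn G (brillouin d)) {η : ℝ}
    (hmod : ∀ p ∈ brillouin d, ∀ q ∈ brillouin d, dist p q ≤ gridStep L → ‖G p - G q‖ ≤ η) :
    ‖cornerRiemannSum G L - ∫ p in brillouin d, G p‖ ≤ (2 * π) ^ d * η := by
  have hint : IntegrableOn G (brillouin d) volume :=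
    hG.integrableOn_compact (isCompact_brillouin d)
  -- cellwise estimate
  have hcell : ∀ j : TorusSite d L,
      ‖(gridStep L) ^ d • G (cellCorner j) - ∫ p in gridCell j, G p‖ ≤ η * (gridStep L) ^ d := by
    intro j
    have hsub : gridCell j ⊆ brillouin d := gridCell_subset_brillouin j
    have hintj : IntegrableOn G (gridCell j) volume := hint.mono_set hsub
    have hvol : volume.real (gridCell j) = gridStep L ^ d := by
      rw [Measure.real, volume_gridCell_toReal]
    have hc : IntegrableOn (fun _ : Fin d → ℝ => G (cellCorner j)) (gridCell j) volume :=
      integrableOn_const (hs := (volume_gridCell_lt_top j).ne)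
    rw [smul_eq_setIntegral_const j, ← integral_sub hc hintj, ← hvol]
    refine norm_setIntegral_le_of_norm_le_const (volume_gridCell_lt_top j) fun p hp => ?_
    refine hmod _ (hsub (cellCorner_mem_gridCell j)) p (hsub hp) ?_
    rw [dist_comm]
    exact dist_cellCorner_le_of_mem_gridCell hp
  -- sum the cellwise estimates
  rw [cornerRiemannSum_eq, setIntegral_brillouin_eq_sum_gridCell' L hint, ← Finset.sum_sub_distrib]
  calc ‖∑ j : TorusSite d L, ((gridStep L) ^ d • G (cellCorner j) - ∫ p in gridCell j, G p)‖
      ≤ ∑ j : TorusSite d L, ‖(gridStep L) ^ d • G (cellCorner j) - ∫ p in gridCell j, G p‖ :=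
        norm_sum_le _ _
    _ ≤ ∑ _j : TorusSite d L, η * (gridStep L) ^ d := Finset.sum_le_sum fun j _ => hcell j
    _ = (2 * π) ^ d * η := by
        rw [Finset.sum_const, Finset.card_univ, card_torusSite, nsmul_eq_mul, ← gridStep_mul L,
          mul_pow]
        push_cast
        ring

/-- **Rate for corner Riemann sums of a Lipschitz integrand**: for `G` `K`-Lipschitz on `[-π,π]^d`
(sup metric), `‖δ^d Σ_j G(c_j) - ∫_{[-π,π]^d} G‖ ≤ (2π)^d · K · δ`, `δ = 2π/L`.
[cite: Rudin1976, Thm. 6.8 / 6.10] -/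
theorem norm_cornerRiemannSum_sub_integral_le_of_lipschitzOnWith {L : ℕ} [NeZero L]
    {G : (Fin d → ℝ) → E} {K : ℝ≥0} (hG : LipschitzOnWith K G (brillouin d)) :
    ‖cornerRiemannSum G L - ∫ p in brillouin d, G p‖ ≤ (2 * π) ^ d * ((K : ℝ) * gridStep L) := by
  refine norm_cornerRiemannSum_sub_integral_le_of_modulus hG.continuousOn fun p hp q hq hpq => ?_
  rw [← dist_eq_norm]
  exact (hG.dist_le_mul p hp q hq).trans (by gcongr)

/-- The same rate in the form `(2π)^{d+1} K / L`. [cite: Rudin1976, Thm. 6.8 / 6.10] -/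
theorem norm_cornerRiemannSum_sub_integral_le_div {L : ℕ} [NeZero L]
    {G : (Fin d → ℝ) → E} {K : ℝ≥0} (hG : LipschitzOnWith K G (brillouin d)) :
    ‖cornerRiemannSum G L - ∫ p in brillouin d, G p‖ ≤ (2 * π) ^ (d + 1) * K / L := by
  have h := norm_cornerRiemannSum_sub_integral_le_of_lipschitzOnWith (L := L) hG
  have hL : (L : ℝ) ≠ 0 := by exact_mod_cast NeZero.ne L
  calc ‖cornerRiemannSum G L - ∫ p in brillouin d, G p‖ ≤ (2 * π) ^ d * ((K : ℝ) * gridStep L) := h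
    _ = (2 * π) ^ (d + 1) * K / L := by
        unfold gridStep
        field_simp
        ring

/-! ### The momentum grid `2πk/L` is the corner grid shifted by `(π,…,π)` — every `L` -/

/-- `p_k = c_k + (π,…,π)`: the lattice momentum `2πk/L` (representative in `[0,2π)^d`) is the cell
corner `-π + (2π/L)k` shifted by `π` in every coordinate, for every side `L ≥ 1` (the reciprocal torus
`𝕋*_L = (2π/L){0,…,L-1}^d` of Friedli–Velenik). [cite: FriedliVelenikSMLS2017, §10.5.2 (10.41)] -/
theorem latticeMomentum_eq_cellCorner_add_pi {L : ℕ} [NeZero L] (k : TorusSite d L) :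
    latticeMomentum L k = fun i => cellCorner k i + π := by
  funext i
  simp only [latticeMomentum, cellCorner, gridStep]
  ring

omit [NormedSpace ℝ E] [CompleteSpace E] in
/-- The momentum sum is the corner sum of the shifted integrand:
`Σ_k G(2πk/L) = Σ_j G(c_j + π)`, every `L ≥ 1`. [cite: FriedliVelenikSMLS2017, §10.5.2 (10.41)] -/
theorem sum_latticeMomentum_eq_sum_cellCorner_shift {L : ℕ} [NeZero L] (G : (Fin d → ℝ) → E) :
    ∑ k : TorusSite d L, G (latticeMomentum L k) =
      ∑ j : TorusSite d L, G (fun i => cellCorner j i + π) := by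
  refine Finset.sum_congr rfl fun k _ => ?_
  rw [latticeMomentum_eq_cellCorner_add_pi]

omit [CompleteSpace E] in
/-- **Momentum average = normalised corner Riemann sum of the shifted integrand**:
`L^{-d} Σ_k G(2πk/L) = (2π)^{-d} · δ^d Σ_j G(c_j + π)`, every `L ≥ 1` («the reader can recognize a
Riemann sum»). [cite: FriedliVelenikSMLS2017, §10.5.2 (10.41)] -/
theorem momentumAverage_eq_smul_cornerRiemannSum_shift {L : ℕ} [NeZero L] (G : (Fin d → ℝ) → E) :
    ((L ^ d : ℕ) : ℝ)⁻¹ • ∑ k : TorusSite d L, G (latticeMomentum L k) =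
      ((2 * π) ^ d)⁻¹ • cornerRiemannSum (fun q => G (fun i => q i + π)) L := by
  have h2π : (0 : ℝ) < (2 * π) ^ d := by positivity
  have hL0 : (L : ℝ) ^ d ≠ 0 := pow_ne_zero d (by exact_mod_cast NeZero.ne L)
  have hg : gridStep L ≠ 0 := (gridStep_pos L).ne'
  rw [cornerRiemannSum_eq, ← Finset.smul_sum, ← sum_latticeMomentum_eq_sum_cellCorner_shift G,
    smul_smul]
  congr 1
  rw [← gridStep_mul L, mul_pow]
  push_cast
  field_simp

/-- Translation by `(π,…,π)` maps the zone `[-π,π]^d` into `[0,2π]^d`. [folklore] -/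
private theorem add_pi_mem_Icc_pi_of_mem_brillouin {q : Fin d → ℝ} (hq : q ∈ brillouin d) :
    (fun i => q i + π) ∈ Set.pi Set.univ fun _ : Fin d => Set.Icc (0 : ℝ) (2 * π) := by
  intro i _
  obtain ⟨h1, h2⟩ := hq i (Set.mem_univ i)
  constructor <;> linarith

/-- Translation by a constant vector is an isometry of the sup metric. [folklore] -/
private theorem dist_add_const_pi (p q : Fin d → ℝ) (c : ℝ) :
    dist (fun i => p i + c) (fun i => q i + c) = dist p q := by
  have hp : (fun i => p i + c) = p + fun _ => c := rfl
  have hq : (fun i => q i + c) = q + fun _ => c := rfl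
  rw [hp, hq, dist_add_right]

omit [NormedSpace ℝ E] [CompleteSpace E] in
/-- A `K`-Lipschitz function on `[0,2π]^d` gives a `K`-Lipschitz shifted function on `[-π,π]^d`.
[folklore] -/
private theorem lipschitzOnWith_shift_of_lipschitzOnWith {G : (Fin d → ℝ) → E} {K : ℝ≥0}
    (hG : LipschitzOnWith K G (Set.pi Set.univ fun _ : Fin d => Set.Icc (0 : ℝ) (2 * π))) :
    LipschitzOnWith K (fun q : Fin d → ℝ => G (fun i => q i + π)) (brillouin d) := by
  refine LipschitzOnWith.of_dist_le_mul fun p hp q hq => ?_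
  have h := hG.dist_le_mul _ (add_pi_mem_Icc_pi_of_mem_brillouin hp) _
    (add_pi_mem_Icc_pi_of_mem_brillouin hq)
  rwa [dist_add_const_pi] at h

/-! ### The rate for momentum averages -/

/-- **Rate for momentum averages of a Lipschitz integrand, every side `L ≥ 1`.** For `G`
`K`-Lipschitz on `[0,2π]^d` (sup metric),
`‖L^{-d} Σ_{k ∈ (ℤ/Lℤ)^d} G(2πk/L) - (2π)^{-d} ∫_{[-π,π]^d} G(q + π) dq‖ ≤ K · 2π/L`.
(For a `2π`-periodic `G` the shifted integral is `∫_{[-π,π]^d} G`.)  This is the quantitative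
«sums to integrals» step behind per-volume rate statements of finite-volume lattice perturbation
theory. [cite: FriedliVelenikSMLS2017, §10.5.2 (10.41)] -/
theorem norm_momentumAverage_sub_integral_le_of_lipschitzOnWith {L : ℕ} [NeZero L]
    {G : (Fin d → ℝ) → E} {K : ℝ≥0}
    (hG : LipschitzOnWith K G (Set.pi Set.univ fun _ : Fin d => Set.Icc (0 : ℝ) (2 * π))) :
    ‖((L ^ d : ℕ) : ℝ)⁻¹ • ∑ k : TorusSite d L, G (latticeMomentum L k) -
        ((2 * π) ^ d)⁻¹ • ∫ q in brillouin d, G (fun i => q i + π)‖ ≤ K * gridStep L := by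
  have h2π : (0 : ℝ) < (2 * π) ^ d := by positivity
  have h := norm_cornerRiemannSum_sub_integral_le_of_lipschitzOnWith (L := L)
    (lipschitzOnWith_shift_of_lipschitzOnWith hG)
  rw [momentumAverage_eq_smul_cornerRiemannSum_shift, ← smul_sub, norm_smul, norm_inv,
    Real.norm_of_nonneg h2π.le, inv_mul_le_iff₀ h2π]
  exact h

/-- The same rate in the form `2π K / L`. [cite: FriedliVelenikSMLS2017, §10.5.2 (10.41)] -/
theorem norm_momentumAverage_sub_integral_le_div {L : ℕ} [NeZero L]
    {G : (Fin d → ℝ) → E} {K : ℝ≥0}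
    (hG : LipschitzOnWith K G (Set.pi Set.univ fun _ : Fin d => Set.Icc (0 : ℝ) (2 * π))) :
    ‖((L ^ d : ℕ) : ℝ)⁻¹ • ∑ k : TorusSite d L, G (latticeMomentum L k) -
        ((2 * π) ^ d)⁻¹ • ∫ q in brillouin d, G (fun i => q i + π)‖ ≤ 2 * π * K / L := by
  have h := norm_momentumAverage_sub_integral_le_of_lipschitzOnWith (L := L) hG
  unfold gridStep at h
  calc _ ≤ (K : ℝ) * (2 * π / L) := h
    _ = 2 * π * K / L := by ring

/-- **Rate for momentum averages from a modulus at the grid scale, every side `L ≥ 1`.** If `G` is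
continuous on `[0,2π]^d` and `‖G p - G q‖ ≤ η` whenever `p, q ∈ [0,2π]^d` are at sup-distance
`≤ 2π/L`, then `‖L^{-d} Σ_k G(2πk/L) - (2π)^{-d} ∫_{[-π,π]^d} G(q + π) dq‖ ≤ η`.
[cite: Rudin1976, Thm. 6.8 / 6.10] -/
theorem norm_momentumAverage_sub_integral_le_of_modulus {L : ℕ} [NeZero L]
    {G : (Fin d → ℝ) → E}
    (hG : ContinuousOn G (Set.pi Set.univ fun _ : Fin d => Set.Icc (0 : ℝ) (2 * π))) {η : ℝ}
    (hmod : ∀ p ∈ Set.pi Set.univ fun _ : Fin d => Set.Icc (0 : ℝ) (2 * π),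
      ∀ q ∈ Set.pi Set.univ fun _ : Fin d => Set.Icc (0 : ℝ) (2 * π),
        dist p q ≤ gridStep L → ‖G p - G q‖ ≤ η) :
    ‖((L ^ d : ℕ) : ℝ)⁻¹ • ∑ k : TorusSite d L, G (latticeMomentum L k) -
        ((2 * π) ^ d)⁻¹ • ∫ q in brillouin d, G (fun i => q i + π)‖ ≤ η := by
  have h2π : (0 : ℝ) < (2 * π) ^ d := by positivity
  have hshift : ContinuousOn (fun q : Fin d → ℝ => G (fun i => q i + π)) (brillouin d) := by
    refine hG.comp (Continuous.continuousOn ?_) fun q hq => add_pi_mem_Icc_pi_of_mem_brillouin hq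
    exact continuous_pi fun i => (continuous_apply i).add continuous_const
  have h := norm_cornerRiemannSum_sub_integral_le_of_modulus (L := L) hshift (η := η)
    fun p hp q hq hpq => hmod _ (add_pi_mem_Icc_pi_of_mem_brillouin hp) _
      (add_pi_mem_Icc_pi_of_mem_brillouin hq) (by rwa [dist_add_const_pi])
  rw [momentumAverage_eq_smul_cornerRiemannSum_shift, ← smul_sub, norm_smul, norm_inv,
    Real.norm_of_nonneg h2π.le, inv_mul_le_iff₀ h2π]
  exact h

end Literature.Probability.LatticeModels

end
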